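import Mathlib
import HarnessLib
import Summits.CriticalPhenomena.SAWScalingLimit.Theses.SAWDefectDecoherence
import Summits.CriticalPhenomena.SAWScalingLimit.Theorems.SAWDefectDecoherenceTipMartingaleDefs
import Summits.CriticalPhenomena.SAWScalingLimit.Theorems.SAWDefectDecoherenceSectorSlavingDefs
import Summits.CriticalPhenomena.SAWScalingLimit.Theorems.SAWDefectDecoherenceDefectDecoherenceSsTipRegrouping
import Summits.CriticalPhenomena.SAWScalingLimit.Theorems.SAWDefectDecoherenceDefectDecoherenceSsSectorRowD
import Summits.CriticalPhenomena.SAWScalingLimit.Theorems.SAWDefectDecoherenceDefectDecoherenceSsDefectSlaving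
import Summits.CriticalPhenomena.SAWScalingLimit.Theorems.SAWDefectDecoherenceDefectDecoherenceSsStarMassHarnack

/-!
# Line `sector-slaving` — skeleton for crux `DefectDecoherence`
(stmt-CriticalPhenomena-8549, route `SAWDefectDecoherence`; lead prover-line-stmt-CriticalPhenomena-8549-c2-0,
second reshape (2026-08-16, c2) of the planner's checked skeleton `Lines/sector-slaving.lean` after the first
lead's reshape `Lines/sector_slaving.lean` (seat …-8549-1, skeleton e95fad76))

RESHAPE c2 (same composition idea, same mathematics; the registered stub set shrinks to the OPEN CORE):
* stubs 1, 2, 7 of the first reshape are LANDED theorems and are now imported, not stubs: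
  `stub_tipRegrouping` (p101543, `…SsTipRegrouping.lean`), `stub_sectorRowD` (p103708, `…SsSectorRowD.lean`),
  `stub_defectSlaving` (p105819, `…SsDefectSlaving.lean`);
* stub 3 `stub_starMassHarnack` (`∃ c, c·q < 3 ∧ NeighbourMassBound c`) is split at the skeleton level into
  its honest positive-mass input `stub_tipReturnLoopBound` (uniform bound `N ≤ 8` on the `x_c`-mass of
  self-avoiding RETURN LOOPS at an exterior tip of a simply connected domain — "TipReturnLoops", the input every
  line on this crux owes; OPEN: uniform finiteness of the critical rooted loop mass) and the elementary closure
  `stub_starMassHarnackOfLoopBound` (= `har_starMassHarnack_of_loopBound`: dart Harnack at the tip,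
  `c = 2 + x_c⁻¹ + 2N ≤ 19.85`, `c·q = 2.80 < 3`) — LANDED in wave 1 (p125071, `…SsStarMassHarnack.lean`), now imported;
* stubs 4, 5, 6 (`stub_unstableStarGradient` HARDEST, `stub_signalStarGradient`, `stub_dressedDefectDecay`) are
  unchanged (registered signatures verbatim).
So the line now reads: DefectDecoherence ⇐ TipReturnLoopBound ∧ UnstableStarGradient ∧ SignalStarGradient ∧
DressedDefectDecay (4 registered stubs, all OPEN estimates), by imported theorems and the proved glue below
(`DefectDecoherence_of`); the same reduction is landed as `…Theorems/…SsReduction.lean`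
(`defectDecoherence_of_tipReturnLoopBound_of_sources`, + `ss_tipReturnLoopBound_of_sourceLoopBound`: the loop
bound is a corollary of the existing item `SAWDevelopingMap.SourceLoopBound`, stmt-CriticalPhenomena-8300).

The crux: `∃ C, θ > 3/4` with `‖T(Λ,a,v)‖ ≤ C R^{-θ} M(Λ,a,v)` for every simply connected
hexagonal domain `Λ`, adjacent boundary root `a = s(u,w)` (`u ∉ Λ ∋ w`) and `R`-deep vertex `v`
(`T = defect`, `M = mass`; definitionally `∃ C θ, 3/4 < θ ∧ DecayBound defect C θ`).

THE LINE (card `Lines/sector-slaving.md`).  Resolve the `x_c`-weighted walks from the root by the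
DART through which they arrive at a vertex and by the LIFTED arrival angle `Θ = θ_a + W`; the clean
vertex-arrival law at `z` has three `ℤ/3`-characters `A_ξ(z)` (`arrivalSum`), `ξ ∈ {U = -3/8,
S = 5/8, D = 13/8}`, and the full via-dart sums `Ā_ξ(z)` (`viaSum`).  Two EXACT identities carry
the crux onto these objects: `T(v) = κ·(x_c⁻¹ Ā_D(v) + 2 sin(π/24) A_D(v))` together with
`M(v) = x_c⁻¹ Ā_0(v) + 2 A_0(v)` (stub 1, `stub_tipRegrouping`), and the `D`-row of the
nearest-neighbour sector system `Ā_D(v) = rowD` (stub 2, `stub_sectorRowD`), whose first two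
sources are pure differences over the star and whose diagonal coupling is
`q = 2x_c sin(π/24) = 0.1413 < 1`.  Hence the defect is algebraically slaved: a discrete
maximum-principle induction on the depth (stub 7, `stub_defectSlaving`, contraction `qc/3 < 1` per
lattice step, `c` from stub 3 `stub_starMassHarnack`) turns decay of the two free-sector
differences (stub 4 `stub_unstableStarGradient` = HARDEST, stub 5 `stub_signalStarGradient`) and of
the loop-dressed defect (stub 6 `stub_dressedDefectDecay`) into decay of the clean defect sector,
and `DefectDecoherence_of` (proved: triangle inequality, `‖κ‖ ≤ 1`, exponent `min θᵢ`) concludes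
the crux BY NAME.

RESHAPE relative to the planner's skeleton (same seven stubs, same mathematics): the vocabulary is
the landed `Theorems/SAWDefectDecoherenceSectorSlavingDefs.lean` (+ the shared
`…TipMartingaleDefs.lean`: `defect`, `mass`, `star`, `Deep`, `xc`); every stub signature is
spelled through the parametrised predicates `DecayBound`, `NeighbourMassBound`,
`AprioriArrivalBound` (no closed statement `def`s); stub 7 takes the a-priori bound
`‖A_ξ(v)‖ ≤ M(v)/2` as an explicit hypothesis (`AprioriArrivalBound (1/2)`), which the composition
derives from stub 1's mass identity (`aprioriArrivalBound_of_massIdentity`, proved here) — in the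
planner's skeleton that bound was silently needed inside stub 7.

Disproof honoured (`defectDecoherence_false_without_depth`, cdisprove cycle 1): the `R`-ball
hypothesis is carried verbatim by stubs 4–6 and CONSUMED in stub 7 (each inward lattice step costs
`1/√3` of depth and buys the factor `qc/3 < 1`); stubs 1–2 need only depth `1` resp. `2`.
-/

namespace Summit.CriticalPhenomena.SAWScalingLimit.Cruxes.DefectDecoherence.SectorSlaving

open scoped BigOperators ComplexConjugate Classical
open Literature.Probability.LatticeModels Literature.Probability.RandomPlanarGeometry.SAW
open Summit.CriticalPhenomena.SAWScalingLimit.Theorems.DefectDecoherence.TipMartingale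
open Summit.CriticalPhenomena.SAWScalingLimit.Theorems.DefectDecoherence.SectorSlaving

noncomputable section

/-! ### The seven statements of the line, as named propositions (skeleton-local abbreviations) -/

/-- **Stub 1 — TipRegrouping** (exact): at a `1`-deep `v`, `T(v) = κ·(x_c⁻¹ Ā_D(v) + 2 sin(π/24) A_D(v))`
and `M(v) = x_c⁻¹ Ā_0(v) + 2 A_0(v)`. -/
def TipRegrouping : Prop :=
  ∀ (Λ : Finset HexVertex) (u w : HexVertex), hexGraph.Adj u w → u ∉ Λ → w ∈ Λ →
    ∀ v : HexVertex, Deep Λ v 1 →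
      defect Λ u w v =
          tipPhase u w *
            (((xc⁻¹ : ℝ) : ℂ) * viaSum Λ s(u, w) (rootAngle u w) (13 / 8) v +
              ((2 * Real.sin (Real.pi / 24) : ℝ) : ℂ) *
                arrivalSum Λ s(u, w) (rootAngle u w) (13 / 8) v) ∧
        ((mass Λ u w v : ℝ) : ℂ) =
          ((xc⁻¹ : ℝ) : ℂ) * viaSum Λ s(u, w) (rootAngle u w) 0 v +
            2 * arrivalSum Λ s(u, w) (rootAngle u w) 0 v

/-- **Stub 2 — SectorRowD** (exact): at a `2`-deep `v`, `Ā_D(v) = rowD(v)`. -/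
def SectorRowD : Prop :=
  ∀ (Λ : Finset HexVertex) (u w : HexVertex), hexGraph.Adj u w → u ∉ Λ → w ∈ Λ →
    ∀ v : HexVertex, Deep Λ v 2 → viaSum Λ s(u, w) (rootAngle u w) (13 / 8) v = rowD Λ u w v

/-- **Stub 3 — StarMassHarnack** (positive mass): `Σ_{t∼v} M(t) ≤ c M(v)` with `c q < 3`. -/
def StarMassHarnack : Prop :=
  ∃ c : ℝ, c * slavingCoupling < 3 ∧ NeighbourMassBound c

/-- **Stub 4 — UnstableStarGradient** (HARDEST, open): decay of `Σ_t ē(t)² U(t)` at rate `θ > 3/4`. -/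
def UnstableStarGradient : Prop :=
  ∃ C θ : ℝ, 3 / 4 < θ ∧ DecayBound unstableSource C θ

/-- **Stub 5 — SignalStarGradient** (open): decay of `Σ_t ē(t) S(t)` at rate `θ > 3/4`. -/
def SignalStarGradient : Prop :=
  ∃ C θ : ℝ, 3 / 4 < θ ∧ DecayBound signalSource C θ

/-- **Stub 6 — DressedDefectDecay** (open): decay of `Ā_D − A_D` at rate `θ > 3/4`. -/
def DressedDefectDecay : Prop :=
  ∃ C θ : ℝ, 3 / 4 < θ ∧ DecayBound dressedDefect C θ

/-- The DERIVED node: decay of the clean defect sector `A_D`. -/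
def CleanDefectDecay : Prop :=
  ∃ C θ : ℝ, 3 / 4 < θ ∧ DecayBound cleanDefect C θ

/-- **Stub 7 — DefectSlaving** (elementary given its hypotheses): the slaving induction. -/
def DefectSlaving : Prop :=
  SectorRowD → AprioriArrivalBound (1 / 2) → StarMassHarnack → UnstableStarGradient →
    SignalStarGradient → DressedDefectDecay → CleanDefectDecay

/-- **TipReturnLoopBound N** (the positive-mass input, exposed by reshape c2): in every simply connected
hexagonal domain `Λ'` and at every exterior vertex `t ∉ Λ'` with two neighbours `q ≠ s` inside, the
`x_c`-mass of the self-avoiding walks of `Λ'` from the mid-edge `s(t,q)` to the mid-edge `s(s,t)` — the RETURN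
LOOPS closing a self-avoiding polygon through the tip `t` — is at most `N`.  Verbatim the hypothesis of the
registered `har_returnLoop_bound` / `har_starMassHarnack_of_loopBound`. -/
def TipReturnLoopBound (N : ℝ) : Prop :=
  ∀ (Λ' : Finset HexVertex), hexDomainSimplyConnected Λ' → ∀ (t q s : HexVertex), t ∉ Λ' → q ∈ Λ' →
    s ∈ Λ' → hexGraph.Adj t q → hexGraph.Adj t s → q ≠ s →
      (∑ τ : HexMidEdgeSAW Λ' s(t, q) s(s, t), xc ^ τ.length) ≤ N

/-! ### The stubs (registered; signatures spelled out, definitionally the named statements)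

Stubs 1, 2, 7 of the first reshape are the imported theorems `stub_tipRegrouping`, `stub_sectorRowD`,
`stub_defectSlaving` of `Summit.CriticalPhenomena.SAWScalingLimit.Theorems.DefectDecoherence.SectorSlaving`. -/

/-- stub A (positive mass; OPEN — uniform finiteness of the critical rooted return-loop mass at an exterior
tip; predicted `N̄ ≈ 0.04–0.08`, needed `N ≤ 8`): `∃ N ∈ [0, 8], TipReturnLoopBound N`. -/
theorem stub_tipReturnLoopBound :
    ∃ N : ℝ, 0 ≤ N ∧ N ≤ 8 ∧
      ∀ (Λ' : Finset HexVertex), hexDomainSimplyConnected Λ' → ∀ (t q s : HexVertex), t ∉ Λ' → q ∈ Λ' →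
        s ∈ Λ' → hexGraph.Adj t q → hexGraph.Adj t s → q ≠ s →
          (∑ τ : HexMidEdgeSAW Λ' s(t, q) s(s, t), xc ^ τ.length) ≤ N := by
  sorry

/-- stub 4 — HARDEST: decay of the `∂̄`-difference of the unstable sector (open). -/
theorem stub_unstableStarGradient :
    ∃ C θ : ℝ, 3 / 4 < θ ∧ DecayBound unstableSource C θ := by
  sorry

/-- stub 5 — decay of the `∂`-difference of the signal sector (open). -/
theorem stub_signalStarGradient :
    ∃ C θ : ℝ, 3 / 4 < θ ∧ DecayBound signalSource C θ := by
  sorry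

/-- stub 6 — decay of the loop-dressed defect sum (open). -/
theorem stub_dressedDefectDecay :
    ∃ C θ : ℝ, 3 / 4 < θ ∧ DecayBound dressedDefect C θ := by
  sorry

/-! ### Consistency: each named statement IS its stub / its landed theorem (definitionally) -/

theorem tipRegrouping_holds : TipRegrouping := stub_tipRegrouping
theorem sectorRowD_holds : SectorRowD := stub_sectorRowD
theorem tipReturnLoopBound_holds : ∃ N : ℝ, 0 ≤ N ∧ N ≤ 8 ∧ TipReturnLoopBound N := stub_tipReturnLoopBound
theorem starMassHarnack_holds : StarMassHarnack := by
  obtain ⟨N, hN0, hN8, hN⟩ := stub_tipReturnLoopBound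
  exact har_starMassHarnack_of_loopBound N hN0 hN8 hN
theorem unstableStarGradient_holds : UnstableStarGradient := stub_unstableStarGradient
theorem signalStarGradient_holds : SignalStarGradient := stub_signalStarGradient
theorem dressedDefectDecay_holds : DressedDefectDecay := stub_dressedDefectDecay
theorem defectSlaving_holds : DefectSlaving := stub_defectSlaving

/-! ### Proved glue -/

/-- The a-priori bound `‖A_ξ(v)‖ ≤ M(v)/2` at a `1`-deep vertex follows from the mass identity
`M = x_c⁻¹ Ā_0 + 2 A_0` (second half of stub 1): `‖A_ξ‖ ≤ A_0` termwise, `Ā_0 ≥ 0`. -/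
theorem aprioriArrivalBound_of_massIdentity (hTip : TipRegrouping) : AprioriArrivalBound (1 / 2) := by
  intro Λ u w huw hu hw v hdeep ξ
  obtain ⟨-, hM⟩ := hTip Λ u w huw hu hw v hdeep
  -- the clean arrival mass (a nonnegative real) and the via mass
  set A0 : ℝ := ∑ s ∈ star Λ v, ∑ γ : HexMidEdgeSAW Λ s(u, w) s(s, v),
      (if γ.verts.getLast? = some s ∧ v ∉ γ.verts then xc ^ (γ.length + 1) else 0 : ℝ) with hA0
  set V0 : ℝ := ∑ s ∈ star Λ v, ∑ γ : HexMidEdgeSAW Λ s(u, w) s(s, v),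
      (if γ.verts.getLast? = some s then xc ^ (γ.length + 1) else 0 : ℝ) with hV0
  have hxc : 0 ≤ xc := hexCriticalFugacity_pos_lt_one.1.le
  have hA : arrivalSum Λ s(u, w) (rootAngle u w) 0 v = (A0 : ℂ) := by
    rw [hA0, arrivalSum]
    push_cast
    refine Finset.sum_congr rfl fun s _ => Finset.sum_congr rfl fun γ _ => ?_
    split_ifs <;> simp
  have hV : viaSum Λ s(u, w) (rootAngle u w) 0 v = (V0 : ℂ) := by
    rw [hV0, viaSum]
    push_cast
    refine Finset.sum_congr rfl fun s _ => Finset.sum_congr rfl fun γ _ => ?_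
    split_ifs <;> simp
  have hV0nn : 0 ≤ V0 :=
    Finset.sum_nonneg fun s _ => Finset.sum_nonneg fun γ _ => by
      split_ifs
      · exact pow_nonneg hxc _
      · exact le_rfl
  have hmass : mass Λ u w v = xc⁻¹ * V0 + 2 * A0 := by
    rw [hA, hV] at hM
    exact_mod_cast hM
  have hnorm : ‖arrivalSum Λ s(u, w) (rootAngle u w) ξ v‖ ≤ A0 := norm_arrivalSum_le _ _ _ _ _
  have hxi : 0 ≤ xc⁻¹ * V0 := mul_nonneg (inv_nonneg.2 hxc) hV0nn
  calc ‖arrivalSum Λ s(u, w) (rootAngle u w) ξ v‖ ≤ A0 := hnorm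
    _ ≤ 1 / 2 * mass Λ u w v := by rw [hmass]; linarith

/-- **Composition of the parts (PROVED):** the seven statements give `DecayBound defect C θ` with
`θ = min θ_clean θ_dressed > 3/4`: `‖T‖ ≤ x_c⁻¹‖Ā_D‖ + 2‖A_D‖ ≤ (x_c⁻¹ + 2)‖A_D‖ + x_c⁻¹‖Ā_D − A_D‖`. -/
theorem decayBound_defect_of_parts (hTip : TipRegrouping) (hRow : SectorRowD)
    (hHar : StarMassHarnack) (hU : UnstableStarGradient) (hS : SignalStarGradient)
    (hDress : DressedDefectDecay) (hSlave : DefectSlaving) :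
    ∃ C θ : ℝ, 3 / 4 < θ ∧ DecayBound defect C θ := by
  obtain ⟨C₁, θ₁, hθ₁, hClean⟩ :=
    hSlave hRow (aprioriArrivalBound_of_massIdentity hTip) hHar hU hS hDress
  obtain ⟨C₂, θ₂, hθ₂, hDirty⟩ := hDress
  have hxc : 0 < xc := hexCriticalFugacity_pos_lt_one.1
  have hxi : 0 ≤ xc⁻¹ := le_of_lt (inv_pos.mpr hxc)
  refine ⟨(xc⁻¹ + 2) * |C₁| + xc⁻¹ * |C₂|, min θ₁ θ₂, lt_min hθ₁ hθ₂, ?_⟩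
  intro Λ hΛ u w huw hu hw v R hR hdeep
  have h1 := hClean Λ hΛ u w huw hu hw v R hR hdeep
  have h2 := hDirty Λ hΛ u w huw hu hw v R hR hdeep
  have hdeep1 : Deep Λ v 1 := fun y hy => hdeep y (hy.trans hR)
  obtain ⟨hT, -⟩ := hTip Λ u w huw hu hw v hdeep1
  -- abbreviations
  set A := arrivalSum Λ s(u, w) (rootAngle u w) (13 / 8) v with hAdef
  set Ab := viaSum Λ s(u, w) (rootAngle u w) (13 / 8) v with hAbdef
  set M := mass Λ u w v with hMdef
  have hA' : cleanDefect Λ u w v = A := rfl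
  have hAb' : dressedDefect Λ u w v = Ab - A := rfl
  rw [hA'] at h1
  rw [hAb'] at h2
  have hM0 : 0 ≤ M := mass_nonneg Λ u w v
  have hR0 : 0 ≤ R := le_trans zero_le_one hR
  have hmono₁ : R ^ (-θ₁) ≤ R ^ (-min θ₁ θ₂) :=
    Real.rpow_le_rpow_of_exponent_le hR (neg_le_neg (min_le_left θ₁ θ₂))
  have hmono₂ : R ^ (-θ₂) ≤ R ^ (-min θ₁ θ₂) :=
    Real.rpow_le_rpow_of_exponent_le hR (neg_le_neg (min_le_right θ₁ θ₂))
  have e1 : ‖A‖ ≤ |C₁| * (R ^ (-min θ₁ θ₂) * M) := by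
    calc ‖A‖ ≤ C₁ * R ^ (-θ₁) * M := h1
      _ ≤ |C₁| * R ^ (-θ₁) * M :=
          mul_le_mul_of_nonneg_right
            (mul_le_mul_of_nonneg_right (le_abs_self _) (Real.rpow_nonneg hR0 _)) hM0
      _ ≤ |C₁| * R ^ (-min θ₁ θ₂) * M :=
          mul_le_mul_of_nonneg_right (mul_le_mul_of_nonneg_left hmono₁ (abs_nonneg _)) hM0
      _ = |C₁| * (R ^ (-min θ₁ θ₂) * M) := by ring
  have e2 : ‖Ab - A‖ ≤ |C₂| * (R ^ (-min θ₁ θ₂) * M) := by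
    calc ‖Ab - A‖ ≤ C₂ * R ^ (-θ₂) * M := h2
      _ ≤ |C₂| * R ^ (-θ₂) * M :=
          mul_le_mul_of_nonneg_right
            (mul_le_mul_of_nonneg_right (le_abs_self _) (Real.rpow_nonneg hR0 _)) hM0
      _ ≤ |C₂| * R ^ (-min θ₁ θ₂) * M :=
          mul_le_mul_of_nonneg_right (mul_le_mul_of_nonneg_left hmono₂ (abs_nonneg _)) hM0
      _ = |C₂| * (R ^ (-min θ₁ θ₂) * M) := by ring
  -- the regrouping identity, in norm
  have hκ : ‖tipPhase u w‖ ≤ 1 := by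
    unfold tipPhase
    rw [norm_mul, Complex.norm_exp_ofReal_mul_I, mul_one, Complex.norm_real, Real.norm_eq_abs,
      abs_neg, abs_of_nonneg (show (0 : ℝ) ≤ Real.sqrt 3 / 6 by positivity)]
    have h3 : Real.sqrt 3 ≤ 6 := by
      nlinarith [Real.sq_sqrt (show (0 : ℝ) ≤ 3 by norm_num), Real.sqrt_nonneg 3]
    linarith
  have hsin : |2 * Real.sin (Real.pi / 24)| ≤ 2 := by
    rw [abs_le]
    constructor
    · nlinarith [Real.neg_one_le_sin (Real.pi / 24)]
    · nlinarith [Real.sin_le_one (Real.pi / 24)]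
  have hX :
      ‖((xc⁻¹ : ℝ) : ℂ) * Ab + ((2 * Real.sin (Real.pi / 24) : ℝ) : ℂ) * A‖ ≤
        xc⁻¹ * ‖Ab‖ + 2 * ‖A‖ := by
    refine (norm_add_le _ _).trans ?_
    rw [norm_mul, norm_mul, Complex.norm_real, Complex.norm_real, Real.norm_eq_abs,
      Real.norm_eq_abs, abs_of_nonneg hxi]
    have : |2 * Real.sin (Real.pi / 24)| * ‖A‖ ≤ 2 * ‖A‖ :=
      mul_le_mul_of_nonneg_right hsin (norm_nonneg _)
    linarith
  have hT' : ‖defect Λ u w v‖ ≤ xc⁻¹ * ‖Ab‖ + 2 * ‖A‖ := by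
    rw [hT, norm_mul]
    have hk := mul_le_mul_of_nonneg_right hκ
      (norm_nonneg (((xc⁻¹ : ℝ) : ℂ) * Ab + ((2 * Real.sin (Real.pi / 24) : ℝ) : ℂ) * A))
    linarith
  have hAb'' : ‖Ab‖ ≤ ‖A‖ + ‖Ab - A‖ := by
    calc ‖Ab‖ = ‖A + (Ab - A)‖ := by congr 1; ring
      _ ≤ ‖A‖ + ‖Ab - A‖ := norm_add_le _ _
  have e3 : xc⁻¹ * ‖Ab‖ ≤ xc⁻¹ * (‖A‖ + ‖Ab - A‖) := mul_le_mul_of_nonneg_left hAb'' hxi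
  have e4 := mul_le_mul_of_nonneg_left e1 hxi
  have e5 := mul_le_mul_of_nonneg_left e2 hxi
  calc ‖defect Λ u w v‖ ≤ xc⁻¹ * ‖Ab‖ + 2 * ‖A‖ := hT'
    _ ≤ xc⁻¹ * (‖A‖ + ‖Ab - A‖) + 2 * ‖A‖ := by linarith
    _ ≤ xc⁻¹ * (|C₁| * (R ^ (-min θ₁ θ₂) * M) + |C₂| * (R ^ (-min θ₁ θ₂) * M)) +
          2 * (|C₁| * (R ^ (-min θ₁ θ₂) * M)) := by
        linarith
    _ = ((xc⁻¹ + 2) * |C₁| + xc⁻¹ * |C₂|) * R ^ (-min θ₁ θ₂) * M := by ring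

/-! ### Composition: the seven stubs imply the crux BY NAME -/

/-- **The conditional reduction of the line** (glue only, no stub used): the crux BY NAME from the four
open inputs `TipReturnLoopBound N` (`N ≤ 8`) + its elementary Harnack closure, `UnstableStarGradient`,
`SignalStarGradient`, `DressedDefectDecay`, everything else being the imported landed theorems. -/
theorem DefectDecoherence_of_inputs
    (hLoop : ∃ N : ℝ, 0 ≤ N ∧ N ≤ 8 ∧ TipReturnLoopBound N)
    (hHarOfLoop : ∀ N : ℝ, 0 ≤ N → N ≤ 8 → TipReturnLoopBound N → StarMassHarnack)
    (hU : UnstableStarGradient) (hS : SignalStarGradient) (hDress : DressedDefectDecay) :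
    Summit.CriticalPhenomena.SAWScalingLimit.Theses.SAWDefectDecoherence.DefectDecoherence := by
  obtain ⟨N, hN0, hN8, hN⟩ := hLoop
  obtain ⟨C, θ, hθ, hD⟩ := decayBound_defect_of_parts stub_tipRegrouping stub_sectorRowD
    (hHarOfLoop N hN0 hN8 hN) hU hS hDress stub_defectSlaving
  exact ⟨C, θ, hθ, fun Λ hΛ u w huw hu hw v R hR hdeep => hD Λ hΛ u w huw hu hw v R hR hdeep⟩

/-- **The line closes the crux BY NAME** (modulo the five registered stubs and nothing else). -/
theorem DefectDecoherence_of :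
    Summit.CriticalPhenomena.SAWScalingLimit.Theses.SAWDefectDecoherence.DefectDecoherence :=
  DefectDecoherence_of_inputs stub_tipReturnLoopBound har_starMassHarnack_of_loopBound
    stub_unstableStarGradient stub_signalStarGradient stub_dressedDefectDecay

end

end Summit.CriticalPhenomena.SAWScalingLimit.Cruxes.DefectDecoherence.SectorSlaving
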